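import Mathlib
import Summits.ValiantsHypothesis.ValiantsHypothesis.Theorems.KPlusLogSqLawLiftingLaguerreWindow

/-!
# The TWO-POINT LAGUERRE RULE: zeros of a real polynomial in `(a, b)` from the expansion of `f/((x−a)(b−x))`

HONEST FRAMING.  Helper file toward the lifting crux `WeakLifting` (stmt-ValiantsHypothesis-19561; aside `Lifting`
stmt-ValiantsHypothesis-19772, registered stub `stub_liftThin`) of route `KPlusLogSqLaw` (cell `pub-symmetroid`, seat
val-sym-lift-p1 g8, 2026-08-27).  A theorem about ONE real polynomial; nothing here asserts `WeakLifting`, `TropicalB`,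
Conjecture B, `MatrixDescartes` (stmt-ValiantsHypothesis-18050) or anything about VP ≠ VNP.

THEOREM (`card_roots_Ioo_le_signVar_twoPoint`, `…'`).  For a non-zero real polynomial `f = Σ c_i X^i` of degree `n` and
`0 < a < b`, the number of distinct zeros of `f` in `(a, b)` is at most the number of sign changes of
`E_j = b^j Σ_{i ≥ j} c_i a^i + a^j Σ_{i < j} c_i b^i` (`j = 0, …, n+1`; `E_0 = f(a)`, `E_{n+1} = a^{n+1} f(b)`).  This is the
two-point form of Laguerre's extension of Descartes' rule ([VanMieghem2010, art. 317, Thm 88]: zeros beyond ONE point `ξ` are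
bounded by the sign changes of the partial sums `Σ_{i ≥ j} c_i ξ^i`, via the expansion of `f(z)/(z − ξ)`): dividing by
`(x − a)(b − x)` instead gives `f/((x−a)(b−x)) = f(a)/((b−a)(x−a)) + G(x) + f(b) x^n/((b−a) b^n (b−x))` with
`G = (b−a)^{−1}(q_a − q_b + f(b) Σ_{k<n} b^{−k−1} X^k)`, `q_a, q_b` the quotients of `f` by `X − a`, `X − b`
(`twoPoint_identity`, Mathlib's `divByMonic`), whose window coefficients are `(b−a)^{−1} a^{−k−1} b^{−k−1} E_{k+1}`
(`twoPoint_coeff`, Mathlib's `coeff_divByMonic_X_sub_C`); the abstract two-sided rule `LocalDescartes.card_le_signVar_window`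
(parts 1–4) then counts the zeros.  Corollary in the next file: the LOCAL DESCARTES RULE between two archimedean dominance points
(GAP-LIFT §4 (S-loc), val-sym-lift-p4).  No `def`.
[folklore] (Laguerre's method).
-/

set_option linter.dupNamespace false
set_option autoImplicit false

namespace Summit.ValiantsHypothesis.ValiantsHypothesis.Theorems.KPlusLogSqLaw.LocalDescartes

open Set Finset
open scoped BigOperators
open Literature.Algebra.Polynomial (signVar signVarAux)

/-! ## The two-point Laguerre rule for a real polynomial -/

/-- telescoping: `(b − X) · Σ_{k<n} b^{−k−1} X^k = 1 − (X/b)^n`. [folklore] -/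
theorem C_sub_X_mul_geom (b : ℝ) (hb : b ≠ 0) (n : ℕ) :
    (Polynomial.C b - Polynomial.X) * (∑ k ∈ Finset.range n, Polynomial.C ((b⁻¹) ^ (k + 1)) * Polynomial.X ^ k)
      = 1 - Polynomial.C ((b⁻¹) ^ n) * Polynomial.X ^ n := by
  induction n with
  | zero => simp
  | succ n ih =>
    rw [Finset.sum_range_succ, mul_add, ih]
    have : Polynomial.C b * Polynomial.C ((b⁻¹) ^ (n + 1)) = Polynomial.C ((b⁻¹) ^ n) := by
      rw [← Polynomial.C_mul]; congr 1; rw [pow_succ]; field_simp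
    calc 1 - Polynomial.C ((b⁻¹) ^ n) * Polynomial.X ^ n
          + (Polynomial.C b - Polynomial.X) * (Polynomial.C ((b⁻¹) ^ (n + 1)) * Polynomial.X ^ n)
        = 1 - Polynomial.C ((b⁻¹) ^ n) * Polynomial.X ^ n
          + (Polynomial.C b * Polynomial.C ((b⁻¹) ^ (n + 1))) * Polynomial.X ^ n
          - Polynomial.C ((b⁻¹) ^ (n + 1)) * (Polynomial.X * Polynomial.X ^ n) := by ring
      _ = 1 - Polynomial.C ((b⁻¹) ^ (n + 1)) * Polynomial.X ^ (n + 1) := by rw [this, ← pow_succ']; ring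

/-- **The two-point division identity.**  With `q_a = f div (X − a)`, `q_b = f div (X − b)` and
`G = (b−a)⁻¹ · (q_a − q_b + f(b) · Σ_{k<n} b^{−k−1} X^k)` (`n = deg f`):
`(X − a)(b − X) · G = f − (f(a)(b − X) + f(b)(X − a)(X/b)^n)/(b − a)` — i.e. `f/((x−a)(b−x)) = f(a)/((b−a)(x−a)) + G(x) +
f(b) x^n /((b−a) b^n (b−x))`, Laguerre's expansion at the two points `a`, `b`. [folklore] -/
theorem twoPoint_identity (f : Polynomial ℝ) {a b : ℝ} (hb : b ≠ 0) (hab : a ≠ b) :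
    (Polynomial.X - Polynomial.C a) * (Polynomial.C b - Polynomial.X) *
        (Polynomial.C ((b - a)⁻¹) * ((f /ₘ (Polynomial.X - Polynomial.C a)) - (f /ₘ (Polynomial.X - Polynomial.C b))
          + Polynomial.C (f.eval b) * ∑ k ∈ Finset.range f.natDegree,
              Polynomial.C ((b⁻¹) ^ (k + 1)) * Polynomial.X ^ k))
      = f - Polynomial.C ((b - a)⁻¹) * (Polynomial.C (f.eval a) * (Polynomial.C b - Polynomial.X)
          + Polynomial.C (f.eval b) * (Polynomial.X - Polynomial.C a) *
            (Polynomial.C ((b⁻¹) ^ f.natDegree) * Polynomial.X ^ f.natDegree)) := by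
  have hqa := Polynomial.modByMonic_add_div f (Polynomial.X - Polynomial.C a)
  have hqb := Polynomial.modByMonic_add_div f (Polynomial.X - Polynomial.C b)
  rw [Polynomial.modByMonic_X_sub_C_eq_C_eval] at hqa hqb
  set qa := f /ₘ (Polynomial.X - Polynomial.C a) with hqa_def
  set qb := f /ₘ (Polynomial.X - Polynomial.C b) with hqb_def
  have hba : (b - a) ≠ 0 := sub_ne_zero.mpr (Ne.symm hab)
  have hgeom := C_sub_X_mul_geom b hb f.natDegree
  -- `(X − a) q_a = f − f(a)`, `(X − b) q_b = f − f(b)`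
  have ea : (Polynomial.X - Polynomial.C a) * qa = f - Polynomial.C (f.eval a) := by
    linear_combination hqa
  have eb : (Polynomial.X - Polynomial.C b) * qb = f - Polynomial.C (f.eval b) := by
    linear_combination hqb
  have key : (Polynomial.X - Polynomial.C a) * (Polynomial.C b - Polynomial.X) *
      (qa - qb + Polynomial.C (f.eval b) * ∑ k ∈ Finset.range f.natDegree,
        Polynomial.C ((b⁻¹) ^ (k + 1)) * Polynomial.X ^ k)
      = Polynomial.C (b - a) * f - (Polynomial.C (f.eval a) * (Polynomial.C b - Polynomial.X)
          + Polynomial.C (f.eval b) * (Polynomial.X - Polynomial.C a) *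
            (Polynomial.C ((b⁻¹) ^ f.natDegree) * Polynomial.X ^ f.natDegree)) := by
    have e1 : (Polynomial.X - Polynomial.C a) * (Polynomial.C b - Polynomial.X) * qa
        = (Polynomial.C b - Polynomial.X) * (f - Polynomial.C (f.eval a)) := by
      rw [← ea]; ring
    have e2 : (Polynomial.X - Polynomial.C a) * (Polynomial.C b - Polynomial.X) * qb
        = -((Polynomial.X - Polynomial.C a) * (f - Polynomial.C (f.eval b))) := by
      rw [← eb]; ring
    have e3 : (Polynomial.X - Polynomial.C a) * (Polynomial.C b - Polynomial.X) *
        (Polynomial.C (f.eval b) * ∑ k ∈ Finset.range f.natDegree, Polynomial.C ((b⁻¹) ^ (k + 1)) * Polynomial.X ^ k)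
        = Polynomial.C (f.eval b) * (Polynomial.X - Polynomial.C a) *
          (1 - Polynomial.C ((b⁻¹) ^ f.natDegree) * Polynomial.X ^ f.natDegree) := by
      rw [← hgeom]; ring
    calc (Polynomial.X - Polynomial.C a) * (Polynomial.C b - Polynomial.X) *
          (qa - qb + Polynomial.C (f.eval b) * ∑ k ∈ Finset.range f.natDegree,
            Polynomial.C ((b⁻¹) ^ (k + 1)) * Polynomial.X ^ k)
        = (Polynomial.X - Polynomial.C a) * (Polynomial.C b - Polynomial.X) * qa
          - (Polynomial.X - Polynomial.C a) * (Polynomial.C b - Polynomial.X) * qb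
          + (Polynomial.X - Polynomial.C a) * (Polynomial.C b - Polynomial.X) *
            (Polynomial.C (f.eval b) * ∑ k ∈ Finset.range f.natDegree,
              Polynomial.C ((b⁻¹) ^ (k + 1)) * Polynomial.X ^ k) := by ring
      _ = _ := by
        rw [e1, e2, e3, Polynomial.C_sub]
        ring
  calc (Polynomial.X - Polynomial.C a) * (Polynomial.C b - Polynomial.X) *
        (Polynomial.C ((b - a)⁻¹) * (qa - qb + Polynomial.C (f.eval b) * ∑ k ∈ Finset.range f.natDegree,
          Polynomial.C ((b⁻¹) ^ (k + 1)) * Polynomial.X ^ k))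
      = Polynomial.C ((b - a)⁻¹) * ((Polynomial.X - Polynomial.C a) * (Polynomial.C b - Polynomial.X) *
        (qa - qb + Polynomial.C (f.eval b) * ∑ k ∈ Finset.range f.natDegree,
          Polynomial.C ((b⁻¹) ^ (k + 1)) * Polynomial.X ^ k)) := by ring
    _ = _ := by
      rw [key, mul_sub, ← mul_assoc, ← Polynomial.C_mul, inv_mul_cancel₀ hba, Polynomial.C_1, one_mul]

/-- **The window coefficients of the two-point expansion, explicitly:** for `k < n`,
`(b − a) a^{k+1} b^{k+1} · G_k = b^{k+1} Σ_{i>k} c_i a^i + a^{k+1} Σ_{i≤k} c_i b^i`. [folklore] -/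
theorem twoPoint_coeff (f : Polynomial ℝ) {a b : ℝ} (hb : b ≠ 0) (hab : a ≠ b) (k : ℕ)
    (hk : k < f.natDegree) :
    (b - a) * a ^ (k + 1) * b ^ (k + 1) *
      (Polynomial.C ((b - a)⁻¹) * ((f /ₘ (Polynomial.X - Polynomial.C a)) - (f /ₘ (Polynomial.X - Polynomial.C b))
          + Polynomial.C (f.eval b) * ∑ k ∈ Finset.range f.natDegree,
              Polynomial.C ((b⁻¹) ^ (k + 1)) * Polynomial.X ^ k)).coeff k
      = b ^ (k + 1) * (∑ i ∈ Finset.Icc (k + 1) f.natDegree, f.coeff i * a ^ i)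
        + a ^ (k + 1) * (∑ i ∈ Finset.range (k + 1), f.coeff i * b ^ i) := by
  have hba : (b - a) ≠ 0 := sub_ne_zero.mpr (Ne.symm hab)
  rw [Polynomial.coeff_C_mul, Polynomial.coeff_add, Polynomial.coeff_sub, Polynomial.coeff_C_mul,
    Polynomial.finsetSum_coeff, Polynomial.coeff_divByMonic_X_sub_C, Polynomial.coeff_divByMonic_X_sub_C]
  simp only [Polynomial.coeff_C_mul, Polynomial.coeff_X_pow, mul_ite, mul_one, mul_zero]
  rw [Finset.sum_ite_eq (Finset.range f.natDegree) k, if_pos (Finset.mem_range.mpr hk)]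
  -- `a^{k+1} Σ a^{i-(k+1)} c_i = Σ c_i a^i` etc.
  have hTa : a ^ (k + 1) * ∑ i ∈ Finset.Icc (k + 1) f.natDegree, a ^ (i - (k + 1)) * f.coeff i
      = ∑ i ∈ Finset.Icc (k + 1) f.natDegree, f.coeff i * a ^ i := by
    rw [Finset.mul_sum]
    refine Finset.sum_congr rfl fun i hi => ?_
    have hik : k + 1 ≤ i := (Finset.mem_Icc.mp hi).1
    rw [← mul_assoc, ← pow_add, Nat.add_sub_cancel' hik, mul_comm]
  have hTb : b ^ (k + 1) * ∑ i ∈ Finset.Icc (k + 1) f.natDegree, b ^ (i - (k + 1)) * f.coeff i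
      = ∑ i ∈ Finset.Icc (k + 1) f.natDegree, f.coeff i * b ^ i := by
    rw [Finset.mul_sum]
    refine Finset.sum_congr rfl fun i hi => ?_
    have hik : k + 1 ≤ i := (Finset.mem_Icc.mp hi).1
    rw [← mul_assoc, ← pow_add, Nat.add_sub_cancel' hik, mul_comm]
  -- `f(b) = Σ_{i ≤ k} c_i b^i + Σ_{k < i ≤ n} c_i b^i`
  have hfb : f.eval b = (∑ i ∈ Finset.range (k + 1), f.coeff i * b ^ i)
      + ∑ i ∈ Finset.Icc (k + 1) f.natDegree, f.coeff i * b ^ i := by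
    rw [Polynomial.eval_eq_sum_range, Finset.range_eq_Ico]
    have h1 : Finset.Icc (k + 1) f.natDegree = Finset.Ico (k + 1) (f.natDegree + 1) := by
      ext i; simp [Finset.mem_Icc, Finset.mem_Ico]
    rw [h1, ← Finset.sum_Ico_consecutive _ (Nat.zero_le (k + 1)) (by omega : k + 1 ≤ f.natDegree + 1),
      Finset.range_eq_Ico]
  have hb1 : b ^ (k + 1) * (b⁻¹) ^ (k + 1) = 1 := by rw [← mul_pow, mul_inv_cancel₀ hb, one_pow]
  calc (b - a) * a ^ (k + 1) * b ^ (k + 1) * ((b - a)⁻¹ *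
        (∑ i ∈ Finset.Icc (k + 1) f.natDegree, a ^ (i - (k + 1)) * f.coeff i
          - ∑ i ∈ Finset.Icc (k + 1) f.natDegree, b ^ (i - (k + 1)) * f.coeff i
          + f.eval b * (b⁻¹) ^ (k + 1)))
      = ((b - a) * (b - a)⁻¹) * (b ^ (k + 1) * (a ^ (k + 1) * ∑ i ∈ Finset.Icc (k + 1) f.natDegree,
            a ^ (i - (k + 1)) * f.coeff i)
          - a ^ (k + 1) * (b ^ (k + 1) * ∑ i ∈ Finset.Icc (k + 1) f.natDegree, b ^ (i - (k + 1)) * f.coeff i)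
          + a ^ (k + 1) * f.eval b * (b ^ (k + 1) * (b⁻¹) ^ (k + 1))) := by ring
    _ = _ := by rw [mul_inv_cancel₀ hba, hTa, hTb, hb1, hfb]; ring


/-- **TWO-POINT LAGUERRE RULE.**  Let `f = Σ c_i X^i` be a non-zero real polynomial of degree `n` and `0 < a < b`.  Then the number
of distinct zeros of `f` in the open interval `(a, b)` is at most the number of sign changes of the sequence
`f(a), δ_0, δ_1, …, δ_{n−1}, f(b)`, where `δ_k = b^{k+1} Σ_{i>k} c_i a^i + a^{k+1} Σ_{i≤k} c_i b^i` — the two-point analogue of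
Laguerre's rule «zeros of `f` beyond `ξ` ≤ sign changes of the partial sums `Σ_{i≥j} c_i ξ^i`» ([VanMieghem2010, art. 317, Thm 88]),
obtained from the expansion of `f/((x − a)(b − x))` (`twoPoint_identity`) and the two-sided Descartes–Laguerre rule on `(a,b)`
(`card_le_signVar_window`).  For `k` below the support the entry `δ_k` has the sign of `f(a)`, above it the sign of `f(b)`. [folklore] -/
theorem card_roots_Ioo_le_signVar_twoPoint (f : Polynomial ℝ) (hf : f ≠ 0) {a b : ℝ} (ha : 0 < a) (hab : a < b) :
    (f.roots.toFinset.filter (fun x => a < x ∧ x < b)).card ≤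
      signVar (f.eval a :: ((List.range f.natDegree).map (fun k =>
          b ^ (k + 1) * (∑ i ∈ Finset.Icc (k + 1) f.natDegree, f.coeff i * a ^ i)
          + a ^ (k + 1) * (∑ i ∈ Finset.range (k + 1), f.coeff i * b ^ i)) ++ [f.eval b])) := by
  classical
  have hb : 0 < b := ha.trans hab
  have hba : 0 < b - a := sub_pos.mpr hab
  set n := f.natDegree with hn
  -- degree `0`: a non-zero constant has no roots
  rcases Nat.eq_zero_or_pos n with hn0 | hnpos
  · have hconst : f = Polynomial.C (f.coeff 0) := Polynomial.eq_C_of_natDegree_eq_zero hn0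
    have hroots : f.roots = 0 := by rw [hconst, Polynomial.roots_C]
    simp [hroots]
  -- the two-point identity, then the window polynomial `G`
  have hid := twoPoint_identity f hb.ne' (ne_of_lt hab)
  set G : Polynomial ℝ := Polynomial.C ((b - a)⁻¹) * ((f /ₘ (Polynomial.X - Polynomial.C a))
      - (f /ₘ (Polynomial.X - Polynomial.C b))
      + Polynomial.C (f.eval b) * ∑ k ∈ Finset.range n, Polynomial.C ((b⁻¹) ^ (k + 1)) * Polynomial.X ^ k) with hG
  have hGdeg : G.natDegree < n := by
    have h1 : (f /ₘ (Polynomial.X - Polynomial.C a)).natDegree ≤ n - 1 := by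
      have := Polynomial.natDegree_divByMonic f (Polynomial.monic_X_sub_C a)
      rw [this, Polynomial.natDegree_X_sub_C]
    have h2 : (f /ₘ (Polynomial.X - Polynomial.C b)).natDegree ≤ n - 1 := by
      have := Polynomial.natDegree_divByMonic f (Polynomial.monic_X_sub_C b)
      rw [this, Polynomial.natDegree_X_sub_C]
    have h3 : (Polynomial.C (f.eval b) * ∑ k ∈ Finset.range n,
        Polynomial.C ((b⁻¹) ^ (k + 1)) * Polynomial.X ^ k).natDegree ≤ n - 1 := by
      refine (Polynomial.natDegree_C_mul_le _ _).trans ?_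
      refine (Polynomial.natDegree_sum_le_of_forall_le _ _ fun k hk => ?_)
      refine (Polynomial.natDegree_C_mul_le _ _).trans ?_
      rw [Polynomial.natDegree_X_pow]
      have := Finset.mem_range.mp hk
      omega
    have h4 : G.natDegree ≤ n - 1 := by
      rw [hG]
      refine (Polynomial.natDegree_C_mul_le _ _).trans ?_
      refine (Polynomial.natDegree_add_le _ _).trans (max_le ((Polynomial.natDegree_sub_le _ _).trans (max_le h1 h2)) h3)
    omega
  -- evaluation of `G` as a window sum with integer exponents
  have hGeval : ∀ x : ℝ, 0 < x → G.eval x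
      = (((List.range n).map (fun k : ℕ => ((k : ℤ), G.coeff k))).map (fun p : ℤ × ℝ => p.2 * x ^ p.1)).sum := by
    intro x hx
    rw [Polynomial.eval_eq_sum_range' hGdeg, List.map_map]
    rw [← List.sum_toFinset _ (List.nodup_range), List.toFinset_range]
    refine Finset.sum_congr rfl fun k _ => ?_
    simp only [Function.comp_apply, zpow_natCast]
  -- the identity `f(x) = (x−a)(b−x) G(x) + f(a)(b−x)/(b−a) + f(b)(x−a)(x/b)^n/(b−a)`
  have hFx : ∀ x : ℝ, a < x → x < b →
      (f.eval a / (b - a)) * ([((1 : ℝ), (0 : ℤ), (-1 : ℤ))].map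
          (fun t : ℝ × ℤ × ℤ => t.1 * (x ^ t.2.1 * (x - a) ^ t.2.2))).sum
        + (((List.range n).map (fun k : ℕ => ((k : ℤ), G.coeff k))).map (fun p : ℤ × ℝ => p.2 * x ^ p.1)).sum
        + (f.eval b / ((b - a) * b ^ n)) * ([((1 : ℝ), (n : ℤ), (-1 : ℤ))].map
          (fun t : ℝ × ℤ × ℤ => t.1 * (x ^ t.2.1 * (b - x) ^ t.2.2))).sum
        = f.eval x / ((x - a) * (b - x)) := by
    intro x hax hxb
    have hx : 0 < x := ha.trans hax
    have hxa : x - a ≠ 0 := (sub_pos.mpr hax).ne'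
    have hbx : b - x ≠ 0 := (sub_pos.mpr hxb).ne'
    rw [← hGeval x hx]
    have hev := congrArg (Polynomial.eval x) hid
    simp only [Polynomial.eval_mul, Polynomial.eval_sub, Polynomial.eval_add, Polynomial.eval_X, Polynomial.eval_C,
      Polynomial.eval_pow, inv_pow] at hev
    simp only [List.map_cons, List.map_nil, List.sum_cons, List.sum_nil, add_zero, zpow_zero, one_mul, zpow_neg,
      zpow_one, zpow_natCast]
    rw [eq_div_iff (mul_ne_zero hxa hbx)]
    have hbn : b ^ n ≠ 0 := pow_ne_zero _ hb.ne'
    have e1 : f.eval x = (x - a) * (b - x) * G.eval x + (b - a)⁻¹ * (f.eval a * (b - x)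
        + f.eval b * (x - a) * ((b ^ n)⁻¹ * x ^ n)) := by linarith
    rw [e1]
    field_simp
    ring
  -- the zeros of `f` in `(a,b)` are zeros of `F = f/((x−a)(b−x))`
  set Z := f.roots.toFinset.filter (fun x => a < x ∧ x < b) with hZ
  have hZmem : ∀ z ∈ Z, z ∈ Set.Ioo a b ∧ f.eval z = 0 := by
    intro z hz
    rw [hZ, Finset.mem_filter, Multiset.mem_toFinset, Polynomial.mem_roots hf] at hz
    exact ⟨hz.2, hz.1⟩
  -- apply the abstract rule
  have hmain := card_le_signVar_window a b ha hab n (-1) (n : ℤ) (f.eval a / (b - a)) (f.eval b / ((b - a) * b ^ n))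
    [((1 : ℝ), (0 : ℤ), (-1 : ℤ))] [((1 : ℝ), (n : ℤ), (-1 : ℤ))] ((List.range n).map (fun k : ℕ => ((k : ℤ), G.coeff k)))
    (by simp) (by omega)
    (by intro t ht; simp only [List.mem_singleton] at ht; subst ht; norm_num)
    (by intro t ht; simp only [List.mem_singleton] at ht; subst ht; norm_num)
    (by
      rw [List.pairwise_map]
      exact List.Pairwise.imp (fun {u v} (h : u < v) => by dsimp only; exact_mod_cast h) List.pairwise_lt_range)
    (by
      intro p hp
      rw [List.mem_map] at hp
      obtain ⟨k, hk, rfl⟩ := hp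
      have := List.mem_range.mp hk
      constructor <;> simp <;> omega)
    Z
    (by
      intro z hz
      obtain ⟨hzI, hz0⟩ := hZmem z hz
      refine ⟨hzI, ?_⟩
      rw [hFx z hzI.1 hzI.2, hz0, zero_div])
    (by
      -- a non-root of `f` in `(a,b)`
      have hinf : (Set.Ioo a b).Infinite := Set.Ioo_infinite hab
      obtain ⟨x₀, hx₀I, hx₀⟩ := hinf.exists_notMem_finset f.roots.toFinset
      refine ⟨x₀, hx₀I, ?_⟩
      rw [hFx x₀ hx₀I.1 hx₀I.2]
      have hfx : f.eval x₀ ≠ 0 := by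
        intro h; exact hx₀ (Multiset.mem_toFinset.mpr ((Polynomial.mem_roots hf).mpr h))
      exact div_ne_zero hfx (mul_ne_zero (sub_pos.mpr hx₀I.1).ne' (sub_pos.mpr hx₀I.2).ne'))
  refine hmain.trans (le_of_eq (signVar_congr ?_))
  -- entrywise the two lists differ by positive factors
  have hc : a < (a + b) / 2 ∧ (a + b) / 2 < b := ⟨by linarith, by linarith⟩
  have hc0 : 0 < (a + b) / 2 := by linarith
  simp only [List.map_cons, List.map_nil, List.sum_cons, List.sum_nil, add_zero, zpow_zero, one_mul, List.map_map]
  refine List.Forall₂.cons ?_ (List.rel_append ?_ (List.Forall₂.cons ?_ List.Forall₂.nil))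
  · -- head: `f(a)/(b−a) · (c−a)^{−1}` vs `f(a)`
    refine signRel_of_posMul (t := (b - a)⁻¹ * ((a + b) / 2 - a) ^ (-1 : ℤ))
      (mul_pos (inv_pos.mpr hba) (zpow_pos (by linarith) _)) ?_
    rw [div_eq_mul_inv]; ring
  · -- window: `G_k` vs `δ_k = (b−a) a^{k+1} b^{k+1} G_k`
    rw [List.forall₂_map_left_iff, List.forall₂_map_right_iff, List.forall₂_same]
    intro k hk
    have hk' : k < n := List.mem_range.mp hk
    simp only [Function.comp_apply]
    have hcoef := twoPoint_coeff f hb.ne' (ne_of_lt hab) k hk'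
    rw [← hG] at hcoef
    refine signRel_of_posMul (t := ((b - a) * a ^ (k + 1) * b ^ (k + 1))⁻¹)
      (inv_pos.mpr (mul_pos (mul_pos hba (pow_pos ha _)) (pow_pos hb _))) ?_
    rw [← hcoef]
    field_simp
  · -- last: `f(b)/((b−a)b^n) · c^n (b−c)^{−1}` vs `f(b)`
    refine signRel_of_posMul (t := ((b - a) * b ^ n)⁻¹ * (((a + b) / 2) ^ (n : ℤ) * (b - (a + b) / 2) ^ (-1 : ℤ)))
      (mul_pos (inv_pos.mpr (mul_pos hba (pow_pos hb _))) (mul_pos (zpow_pos hc0 _) (zpow_pos (by linarith) _))) ?_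
    rw [div_eq_mul_inv]; ring

/-- **Two-point Laguerre rule, uniform indexing.**  Same bound with the single sequence
`E_j = b^j Σ_{i ≥ j} c_i a^i + a^j Σ_{i < j} c_i b^i`, `j = 0, …, n + 1` (`E_0 = f(a)`, `E_{n+1} = a^{n+1} f(b)`). [folklore] -/
theorem card_roots_Ioo_le_signVar_twoPoint' (f : Polynomial ℝ) (hf : f ≠ 0) {a b : ℝ} (ha : 0 < a) (hab : a < b) :
    (f.roots.toFinset.filter (fun x => a < x ∧ x < b)).card ≤
      signVar ((List.range (f.natDegree + 2)).map (fun j =>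
          b ^ j * (∑ i ∈ Finset.Icc j f.natDegree, f.coeff i * a ^ i)
          + a ^ j * (∑ i ∈ Finset.range j, f.coeff i * b ^ i))) := by
  refine (card_roots_Ioo_le_signVar_twoPoint f hf ha hab).trans (le_of_eq (signVar_congr ?_))
  rw [List.range_succ, List.range_succ_eq_map, List.map_append, List.map_cons, List.map_map, List.cons_append,
    List.map_singleton]
  refine List.Forall₂.cons ?_ (List.rel_append ?_ (List.Forall₂.cons ?_ List.Forall₂.nil))
  · -- `E_0 = f(a)`
    have : f.eval a = ∑ i ∈ Finset.Icc 0 f.natDegree, f.coeff i * a ^ i := by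
      rw [Polynomial.eval_eq_sum_range]
      congr 1
      ext i; simp
    rw [this]; simp
  · exact List.forall₂_same.mpr (fun _ _ => ⟨Iff.rfl, Iff.rfl⟩)
  · -- `E_{n+1} = a^{n+1} f(b)`
    have hIcc : Finset.Icc (f.natDegree + 1) f.natDegree = ∅ := Finset.Icc_eq_empty (by omega)
    rw [hIcc, Finset.sum_empty, mul_zero, zero_add, ← Polynomial.eval_eq_sum_range]
    exact signRel_of_posMul (t := (a ^ (f.natDegree + 1))⁻¹) (inv_pos.mpr (pow_pos ha _))
      (by rw [← mul_assoc, inv_mul_cancel₀ (pow_ne_zero _ ha.ne'), one_mul])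

end Summit.ValiantsHypothesis.ValiantsHypothesis.Theorems.KPlusLogSqLaw.LocalDescartes
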